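import Mathlib
import Summits.Ventures.DiscreteObjects.Mahler.CensusKernelDeg22P001
import Summits.Ventures.DiscreteObjects.Mahler.CensusKernelDeg22P002
import Summits.Ventures.DiscreteObjects.Mahler.CensusKernelDeg22P003
import Summits.Ventures.DiscreteObjects.Mahler.CensusKernelDeg22P004
import Summits.Ventures.DiscreteObjects.Mahler.CensusKernelDeg22P005
import Summits.Ventures.DiscreteObjects.Mahler.CensusKernelDeg22P006
import Summits.Ventures.DiscreteObjects.Mahler.CensusKernelDeg22P007
import Summits.Ventures.DiscreteObjects.Mahler.CensusKernelDeg22P008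
import Summits.Ventures.DiscreteObjects.Mahler.CensusKernelDeg22P009
import Summits.Ventures.DiscreteObjects.Mahler.CensusKernelDeg22P010
import Summits.Ventures.DiscreteObjects.Mahler.CensusKernelDeg22P011
import Summits.Ventures.DiscreteObjects.Mahler.CensusKernelDeg22P012
import Summits.Ventures.DiscreteObjects.Mahler.CensusKernelDeg22P013
import Summits.Ventures.DiscreteObjects.Mahler.CensusKernelDeg22P014
import Summits.Ventures.DiscreteObjects.Mahler.CensusKernelDeg22P015
import Summits.Ventures.DiscreteObjects.Mahler.CensusKernelDeg22P016
import Summits.Ventures.DiscreteObjects.Mahler.CensusKernelDeg22P017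
import Summits.Ventures.DiscreteObjects.Mahler.CensusKernelDeg22P018
import Summits.Ventures.DiscreteObjects.Mahler.CensusKernelDeg22P019
import Summits.Ventures.DiscreteObjects.Mahler.CensusKernelDeg22P020
import Summits.Ventures.DiscreteObjects.Mahler.CensusKernelDeg22P021
import Summits.Ventures.DiscreteObjects.Mahler.CensusKernelDeg22P022
import Summits.Ventures.DiscreteObjects.Mahler.CensusKernelDeg22P023
import Summits.Ventures.DiscreteObjects.Mahler.CensusKernelDeg22P024
import Summits.Ventures.DiscreteObjects.Mahler.CensusKernelDeg22P025
import Summits.Ventures.DiscreteObjects.Mahler.CensusKernelDeg22P026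
import Summits.Ventures.DiscreteObjects.Mahler.CensusKernelDeg22P027
import Summits.Ventures.DiscreteObjects.Mahler.CensusKernelDeg22P028
import Summits.Ventures.DiscreteObjects.Mahler.CensusKernelDeg22P029
import Summits.Ventures.DiscreteObjects.Mahler.CensusKernelDeg22P030
import Summits.Ventures.DiscreteObjects.Mahler.CensusKernelDeg22P031
import Summits.Ventures.DiscreteObjects.Mahler.CensusKernelDeg22P032
import Summits.Ventures.DiscreteObjects.Mahler.CensusKernelDeg22P033
import Summits.Ventures.DiscreteObjects.Mahler.CensusKernelDeg22P034
import Summits.Ventures.DiscreteObjects.Mahler.CensusKernelDeg22P035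
import Summits.Ventures.DiscreteObjects.Mahler.CensusKernelDeg22P036
import Summits.Ventures.DiscreteObjects.Mahler.CensusKernelDeg22P037
import Summits.Ventures.DiscreteObjects.Mahler.CensusKernelDeg22P038
import Summits.Ventures.DiscreteObjects.Mahler.CensusKernelDeg22P039
import Summits.Ventures.DiscreteObjects.Mahler.CensusKernelDeg22P040
import Summits.Ventures.DiscreteObjects.Mahler.CensusKernelDeg22P041
import Summits.Ventures.DiscreteObjects.Mahler.CensusKernelDeg22P042
import Summits.Ventures.DiscreteObjects.Mahler.CensusKernelDeg22P043
import Summits.Ventures.DiscreteObjects.Mahler.CensusKernelDeg22P044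
import Summits.Ventures.DiscreteObjects.Mahler.CensusKernelDeg22P045
import Summits.Ventures.DiscreteObjects.Mahler.CensusKernelDeg22P046
import Summits.Ventures.DiscreteObjects.Mahler.CensusKernelDeg22P047
import Summits.Ventures.DiscreteObjects.Mahler.CensusKernelDeg22P048
import Summits.Ventures.DiscreteObjects.Mahler.CensusKernelDeg22P049
import Summits.Ventures.DiscreteObjects.Mahler.CensusKernelDeg22P050
import Summits.Ventures.DiscreteObjects.Mahler.CensusKernelDeg22P051
import Summits.Ventures.DiscreteObjects.Mahler.CensusKernelDeg22P052
import Summits.Ventures.DiscreteObjects.Mahler.CensusKernelDeg22P053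
import Summits.Ventures.DiscreteObjects.Mahler.CensusKernelDeg22P054
import Summits.Ventures.DiscreteObjects.Mahler.CensusKernelDeg22P055
import Summits.Ventures.DiscreteObjects.Mahler.CensusKernelDeg22P056
import Summits.Ventures.DiscreteObjects.Mahler.CensusKernelDeg22P057
import Summits.Ventures.DiscreteObjects.Mahler.CensusKernelDeg22P058
import Summits.Ventures.DiscreteObjects.Mahler.CensusKernelDeg22P059
import Summits.Ventures.DiscreteObjects.Mahler.CensusKernelDeg22P060
import Summits.Ventures.DiscreteObjects.Mahler.CensusKernelDeg22P061
import Summits.Ventures.DiscreteObjects.Mahler.CensusKernelDeg22P062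
import Summits.Ventures.DiscreteObjects.Mahler.CensusKernelDeg22P063
import Summits.Ventures.DiscreteObjects.Mahler.CensusKernelDeg22P064
import Summits.Ventures.DiscreteObjects.Mahler.CensusKernelDeg22P065
import Summits.Ventures.DiscreteObjects.Mahler.CensusKernelDeg22P066
import Summits.Ventures.DiscreteObjects.Mahler.CensusKernelDeg22P067
import Summits.Ventures.DiscreteObjects.Mahler.CensusKernelDeg22P068
import Summits.Ventures.DiscreteObjects.Mahler.CensusKernelDeg22P069
import Summits.Ventures.DiscreteObjects.Mahler.CensusKernelDeg22P070
import Summits.Ventures.DiscreteObjects.Mahler.CensusKernelDeg22P071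

/-!
# Kernel census, degree 22 at `B = 61/50` (part C1): collector 1: imports chunk parts P001…P071

Cell `pub-namedobj`, seat `pub-namedobj-mahler-g17`. Framing: lottery ticket; floor = certified bounds/negative ranges.

Part of the kernel proof of `DegreeCensus 22 (61/50) coresDeg22` (see part A for the method: census search with
Toeplitz/resultant cuts, kernel-certified explicit-auxiliary-function cuts and certified leaf thresholds at `B = 61/50`;
601305 leaves with `c_1 >= 0`, 50871 survivors certified by extended certificates `CertX`: base red/cyc/exc or trace-Graeffe `tgr`).
This part only IMPORTS a range of chunk parts (so that the node-lemma and assembly parts stay under the line limit).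
CONTROL/replication (MRW08 Table 1 row `D = 22`; print complete to degree 44), not new ground.
-/

namespace Summit.Ventures.DiscreteObjects.Mahler

open Polynomial

/-- Collector 1 of the degree-22 kernel census imports chunk parts `P001` … `P071`; as its own (small) fact it records
that the threshold list `T22` has 44 entries (k = 1..4d). -/
theorem T22_length : T22.length = 44 := by decide

end Summit.Ventures.DiscreteObjects.Mahler
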